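import Summits.Ventures.PercRepro.C025ProfilePriceMono
import Summits.Ventures.PercRepro.MatroidTruncate

/-!
# THE TRUNCATION PRINCIPLE FOR THE ROWS OF (Π) (night-3 g25)

`proofs/NIGHT3-G25-GRADED.md` §2.  For a finite matroid `M` and `u < r`, the row `(q, u)` of (Π) for `M` implies the row
`(q, u)` for typer-2's truncation `truncate M r`: below rank `r` the rank-`q` sets and the rank-`u` sets are the same
(`Rq_truncate_eq`, `levelSet_truncate_eq`), and the complement rank only drops, `min(ρ(E∖B), r) ≤ ρ(E∖B)`, while the price
`C(p+q,u)/C(p+q,q)·[u ≤ p]` is non-decreasing in `p` (`price_truncate_le`, by g23's `PriceMono.choose_div_choose_mono`).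
So every row theorem for a matroid is a row theorem for all its truncations (`profileIneq_truncate_of_profileIneq`) — the
step that takes the rows of a direct sum `M₁ ⊕ U_{m,m}` to the rows of «`M₁` plus free points, truncated».
No `def`, no `instance`, no notation.  Axioms: standard.
-/

open scoped Matroid

namespace PercRepro

open Finset ThmH

namespace Profile

variable {α : Type} [DecidableEq α] (M : Matroid α) [M.Finite]

omit [DecidableEq α] in
/-- The ground set of the truncation is the ground set. -/
theorem gr_truncate (r : ℕ) : gr (Matroid.truncate M r) = gr M := by
  apply Finset.coe_injective
  rw [coe_gr, coe_gr, Matroid.truncate_ground]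

omit [DecidableEq α] in
/-- Below the truncation rank the rank-`q` sets are unchanged. -/
theorem Rq_truncate_eq {q r : ℕ} (hqr : q < r) : Profile.Rq (Matroid.truncate M r) q = Profile.Rq M q := by
  ext B
  rw [Profile.mem_Rq, Profile.mem_Rq, gr_truncate, Matroid.truncate_eRk]
  constructor
  · rintro ⟨h1, h2⟩
    refine ⟨h1, ?_⟩
    rcases le_total (M.eRk (B : Set α)) (r : ℕ∞) with h | h
    · rwa [min_eq_left h] at h2
    · rw [min_eq_right h] at h2
      have : (q : ℕ∞) < r := by exact_mod_cast hqr
      rw [← h2] at this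
      exact absurd this (lt_irrefl _)
  · rintro ⟨h1, h2⟩
    refine ⟨h1, ?_⟩
    rw [h2]
    exact min_eq_left (by exact_mod_cast hqr.le)

omit [DecidableEq α] in
/-- Below the truncation rank the level sets are unchanged. -/
theorem levelSet_truncate_eq {u r : ℕ} (hur : u < r) :
    Shadow.levelSet (Matroid.truncate M r) u = Shadow.levelSet M u := by
  ext S
  rw [Profile.mem_levelSet, Profile.mem_levelSet, gr_truncate, Matroid.truncate_eRk]
  constructor
  · rintro ⟨h1, h2⟩
    refine ⟨h1, ?_⟩
    rcases le_total (M.eRk (S : Set α)) (r : ℕ∞) with h | h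
    · rwa [min_eq_left h] at h2
    · rw [min_eq_right h] at h2
      have : (u : ℕ∞) < r := by exact_mod_cast hur
      rw [← h2] at this
      exact absurd this (lt_irrefl _)
  · rintro ⟨h1, h2⟩
    refine ⟨h1, ?_⟩
    rw [h2]
    exact min_eq_left (by exact_mod_cast hur.le)

/-- The price of a set in the truncation is at most its price in `M` (the complement rank only drops; the price is
non-decreasing in it). -/
theorem price_truncate_le {q u : ℕ} (hqu : q ≤ u) (r : ℕ) (B : Finset α) :
    Profile.price (Matroid.truncate M r) q u B ≤ Profile.price M q u B := by
  have hfin : M.eRk ((gr M \ B : Finset α) : Set α) ≠ ⊤ := by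
    have := M.eRk_le_eRank ((gr M \ B : Finset α) : Set α)
    exact ne_top_of_le_ne_top (M.eRank_ne_top_iff.2 inferInstance) this
  obtain ⟨p, hp⟩ : ∃ p : ℕ, M.eRk ((gr M \ B : Finset α) : Set α) = (p : ℕ∞) :=
    ⟨_, (ENat.coe_toNat hfin).symm⟩
  have hmin : ((min p r : ℕ) : ℕ∞) = min (p : ℕ∞) (r : ℕ∞) := by
    rcases le_total p r with h | h
    · rw [min_eq_left h, min_eq_left (by exact_mod_cast h)]
    · rw [min_eq_right h, min_eq_right (by exact_mod_cast h)]
  have hp' : (Matroid.truncate M r).eRk ((gr (Matroid.truncate M r) \ B : Finset α) : Set α) = ((min p r : ℕ) : ℕ∞) := by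
    rw [gr_truncate, Matroid.truncate_eRk, hp, hmin]
  by_cases hup : u ≤ min p r
  · rw [PriceMono.price_eq_of_le hp' hup, PriceMono.price_eq_of_le hp (le_trans hup (min_le_left _ _))]
    exact PriceMono.choose_div_choose_mono hqu hup (min_le_left _ _)
  · have : Profile.price (Matroid.truncate M r) q u B = 0 := by
      unfold Profile.price
      rw [hp', if_neg (by exact_mod_cast hup)]
    rw [this]
    exact Profile.price_nonneg _ _ _

/-- **THE TRUNCATION PRINCIPLE**: the row `(q, u)` of (Π) for `M` implies the row `(q, u)` for `truncate M r`, for every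
`q < u < r`. -/
theorem profileIneq_truncate_of_profileIneq {q u r : ℕ} (hqu : q < u) (hur : u < r)
    (h : Profile.ProfileIneq M q u) : Profile.ProfileIneq (Matroid.truncate M r) q u := by
  unfold Profile.ProfileIneq at h ⊢
  rw [Rq_truncate_eq M (by omega), levelSet_truncate_eq M hur]
  calc ∑ B ∈ Profile.Rq M q, Profile.price (Matroid.truncate M r) q u B
      ≤ ∑ B ∈ Profile.Rq M q, Profile.price M q u B :=
        sum_le_sum (fun B _ => price_truncate_le M hqu.le r B)
    _ ≤ ((Shadow.levelSet M u).card : ℚ) := h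

end Profile

end PercRepro
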